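import Literature.RepresentationTheory.HeisenbergGroup.MetaplecticBoxHom
import HarnessLib

/-!
# The operator of the MVW pair `j̃(p₁, p₂)` as a product operator `sumEndSB` (bridge lemmas)

Topic `RepresentationTheory/HeisenbergGroup`; namespace `Literature.RepresentationTheory.HeisenbergGroup`.  THEOREMS ONLY
(no definition, no named fact, no `sorry`).  Two spellings of «`M₁ ⊠ M₂` on `𝒮(K^ι) = 𝒮(K^{ι₁}) ⊗ 𝒮(K^{ι₂})`» live in the tree:
the linear AUTOMORPHISM `boxEquivSB K e M₁ M₂` (`DoubledDeltaDoublingIdentity`, used by the box homomorphism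
`MpPsi.boxPair` / `MpPsi.boxHom` of `MetaplecticBoxHom`, [MoeglinVignerasWaldspurger1987, Chap. 2 II.1 Rem. (6)]:
`j̃(p₁, p₂) = (π p₁ ⊕ π p₂, op p₁ ⊠ op p₂)`), and the linear ENDOMORPHISM `sumEndSB K e B₁ B₂` (`LocalSchwartzBruhatDirectSum`,
used by quasi-invariance statements such as `MoeglinVignerasWaldspurger1987.exists_doubledFunctional_of_areIsomorphicRep`).
Both are `sumEquivSB ∘ (M₁ ⊗ M₂) ∘ sumEquivSB⁻¹`; this file records the identification and its consequences for `j̃`: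

* `boxEquivSB_toLinearMap` — `(boxEquivSB K e M₁ M₂ : _ →ₗ _) = sumEndSB K e M₁ M₂`;
* `MpPsi.toRep_eq_toOp` — the tautological representation `MpPsi.toRep ρ p` IS the operator `MpPsi.toOp ρ p` (as a linear map);
* `MpPsi.toOp_conjPair` — the operator of `conjPair p` is `conjOp (op p)`;
* `MpPsi.coe_toOp_boxPair_eq_sumEndSB` / `MpPsi.toRep_boxPair_eq_sumEndSB` — the operator of `j̃(p₁, p₂)` is
  `sumEndSB K e (op p₁) (op p₂)` (`ω_⊕ ∘ j̃ = ω₁ ⊠ ω₂` as linear maps);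
* `MpPsi.coe_toOp_boxPair_conjPair_eq_sumEndSB` / `MpPsi.toRep_boxPair_conjPair_eq_sumEndSB` — the operator of the
  «diagonal doubling» `j̃(p₁, conj p₂)` is `sumEndSB K e (op p₁) (conjOp (op p₂))` — the shape in which the doubled
  quasi-invariant functional of a pair of rank-one theta lifts is stated
  (`MoeglinVignerasWaldspurger1987.exists_doubledFunctional_of_areIsomorphicRep`; cell `hodgecm-mathlib`, row IV-4 (c1),
  pieces P1 ↔ P5/P7; with `GelbartRogawski1991.….toOp_diagonalDoubling` (rfl) a consumer rewrites
  `rw [toOp_diagonalDoubling, boxEquivSB_toLinearMap]`).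

(The continuity witnesses `hb₁`/`hb₂`/`hb` that `boxPair`/`conjPair` take are the tree's public
`continuous_toLinearMap₂'_left` (`SchrodingerDirectSum`) and `continuous_toLinearMap₂'_neg_left` (`SchrodingerConjugateGram`).)

## References
* [MoeglinVignerasWaldspurger1987] C. Mœglin, M.-F. Vignéras, J.-L. Waldspurger, LNM 1291 (1987), Chap. 2 II.1 (A), Rem. (6).
* [Kudla1996] S. Kudla, *Notes on the local theta correspondence* (1996), Chap. I §1 (`j̃`).
-/

set_option autoImplicit false

noncomputable section

namespace Literature.RepresentationTheory.HeisenbergGroup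

open Literature.NumberTheory.Automorphic

/-! ## §1 `boxEquivSB` versus `sumEndSB` -/

section BoxEquiv

variable (K : Type*) [Field K] [ValuativeRel K] [TopologicalSpace K] [IsNonarchimedeanLocalField K]
  {ι₁ ι₂ ι : Type*} [Fintype ι₁] [Fintype ι₂] [Fintype ι] [DecidableEq ι₁] [DecidableEq ι₂] [DecidableEq ι]
  (e : ι₁ ⊕ ι₂ ≃ ι)

omit [DecidableEq ι₁] [DecidableEq ι₂] [DecidableEq ι] in
/-- **`M₁ ⊠ M₂` as an automorphism and as an endomorphism agree**: `(boxEquivSB K e M₁ M₂ : _ →ₗ _) = sumEndSB K e M₁ M₂`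
(both are `sumEquivSB ∘ (M₁ ⊗ M₂) ∘ sumEquivSB⁻¹`). [cite: MoeglinVignerasWaldspurger1987, Chap. 2 II.1 Rem. (6)] -/
theorem boxEquivSB_toLinearMap (M₁ : SchwartzBruhat (ι₁ → K) ≃ₗ[ℂ] SchwartzBruhat (ι₁ → K))
    (M₂ : SchwartzBruhat (ι₂ → K) ≃ₗ[ℂ] SchwartzBruhat (ι₂ → K)) :
    ((boxEquivSB K e M₁ M₂ : SchwartzBruhat (ι → K) ≃ₗ[ℂ] SchwartzBruhat (ι → K)) :
        SchwartzBruhat (ι → K) →ₗ[ℂ] SchwartzBruhat (ι → K)) =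
      sumEndSB K e (M₁ : SchwartzBruhat (ι₁ → K) →ₗ[ℂ] SchwartzBruhat (ι₁ → K))
        (M₂ : SchwartzBruhat (ι₂ → K) →ₗ[ℂ] SchwartzBruhat (ι₂ → K)) := by
  apply LinearMap.ext
  intro f
  -- reduce to pure tensors through `sumEquivSB`
  obtain ⟨w, rfl⟩ := (sumEquivSB K e).surjective f
  induction w using TensorProduct.induction_on with
  | zero => simp
  | tmul f₁ f₂ =>
      rw [sumEquivSB_tmul, LinearEquiv.coe_coe, boxEquivSB_boxSB, sumEndSB_boxSB]
      rfl
  | add x y hx hy => simp only [map_add, hx, hy]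

end BoxEquiv

/-! ## §2 Operators of `p`, `conjPair p` and `j̃(p₁, p₂)` -/

section Operators

variable {R : Type*} [CommRing R] [Invertible (2 : R)] {V : Type*} [AddCommGroup V] [Module R V]
  {B : V →ₗ[R] V →ₗ[R] R} {k : Type*} [Field k] {S : Type*} [AddCommGroup S] [Module k S]
  (ρ : Representation k (Heisenberg B) S)

/-- the tautological representation of `S̃p_ψ` is the operator component: `toRep ρ p = (toOp ρ p : S →ₗ S)`.
[cite: MoeglinVignerasWaldspurger1987, Chap. 2 II.1 (A)] -/
theorem MpPsi.toRep_eq_toOp (p : MpPsi ρ) :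
    (MpPsi.toRep ρ p : S →ₗ[k] S) = ((MpPsi.toOp ρ p : S ≃ₗ[k] S) : S →ₗ[k] S) :=
  rfl

end Operators

section Box

variable {K : Type*} [Field K] [ValuativeRel K] [TopologicalSpace K] [IsNonarchimedeanLocalField K]
  [Invertible (2 : K)] {ι₁ ι₂ ι : Type*} [Fintype ι₁] [Fintype ι₂] [Fintype ι]
  [DecidableEq ι₁] [DecidableEq ι₂] [DecidableEq ι]
  (e : ι₁ ⊕ ι₂ ≃ ι) (T₁ : Matrix ι₁ ι₁ K) (T₂ : Matrix ι₂ ι₂ K) {T : Matrix ι ι K}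
  (hT : T = Matrix.reindex e e (Matrix.fromBlocks T₁ 0 0 T₂))
  {ψ : AddChar K Circle} (hl : IsLocallyConstant (⇑ψ : K → Circle))
  (hb₁ : ∀ y : ι₁ → K, Continuous fun u : ι₁ → K => Matrix.toLinearMap₂' K T₁ u y)
  (hb₂ : ∀ y : ι₂ → K, Continuous fun u : ι₂ → K => Matrix.toLinearMap₂' K T₂ u y)
  (hb : ∀ y : ι → K, Continuous fun u : ι → K => Matrix.toLinearMap₂' K T u y)

/-- **The operator of `j̃(p₁, p₂)` is `op p₁ ⊠ op p₂ = sumEndSB K e (op p₁) (op p₂)`** (as a linear map).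
[cite: MoeglinVignerasWaldspurger1987, Chap. 2 II.1 Rem. (6)] [cite: Kudla1996, Chap. I §1] -/
theorem MpPsi.coe_toOp_boxPair_eq_sumEndSB (p₁ : MpPsi (schrodingerSB (Matrix.toLinearMap₂' K T₁) ψ hl hb₁))
    (p₂ : MpPsi (schrodingerSB (Matrix.toLinearMap₂' K T₂) ψ hl hb₂)) :
    ((MpPsi.toOp _ (MpPsi.boxPair e T₁ T₂ hT hl hb₁ hb₂ hb p₁ p₂) :
        SchwartzBruhat (ι → K) ≃ₗ[ℂ] SchwartzBruhat (ι → K)) : SchwartzBruhat (ι → K) →ₗ[ℂ] SchwartzBruhat (ι → K)) =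
      sumEndSB K e ((MpPsi.toOp _ p₁ : SchwartzBruhat (ι₁ → K) ≃ₗ[ℂ] _) : SchwartzBruhat (ι₁ → K) →ₗ[ℂ] _)
        ((MpPsi.toOp _ p₂ : SchwartzBruhat (ι₂ → K) ≃ₗ[ℂ] _) : SchwartzBruhat (ι₂ → K) →ₗ[ℂ] _) := by
  rw [MpPsi.toOp_boxPair, boxEquivSB_toLinearMap]

/-- **`ω_⊕ ∘ j̃ = ω₁ ⊠ ω₂` as linear maps**: `toRep ρ_⊕ (j̃(p₁, p₂)) = sumEndSB K e (toRep ρ₁ p₁) (toRep ρ₂ p₂)`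
(`ρ_⊕`, `ρ₁`, `ρ₂` the Schrödinger models with Gram matrices `T = T₁ ⊕ T₂`, `T₁`, `T₂`).
[cite: MoeglinVignerasWaldspurger1987, Chap. 2 II.1 Rem. (6)] [cite: Kudla1996, Chap. I §1] -/
theorem MpPsi.toRep_boxPair_eq_sumEndSB (p₁ : MpPsi (schrodingerSB (Matrix.toLinearMap₂' K T₁) ψ hl hb₁))
    (p₂ : MpPsi (schrodingerSB (Matrix.toLinearMap₂' K T₂) ψ hl hb₂)) :
    MpPsi.toRep (schrodingerSB (Matrix.toLinearMap₂' K T) ψ hl hb) (MpPsi.boxPair e T₁ T₂ hT hl hb₁ hb₂ hb p₁ p₂) =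
      sumEndSB K e (MpPsi.toRep (schrodingerSB (Matrix.toLinearMap₂' K T₁) ψ hl hb₁) p₁)
        (MpPsi.toRep (schrodingerSB (Matrix.toLinearMap₂' K T₂) ψ hl hb₂) p₂) :=
  MpPsi.coe_toOp_boxPair_eq_sumEndSB e T₁ T₂ hT hl hb₁ hb₂ hb p₁ p₂

end Box

section Conj

variable {R : Type*} [CommRing R] [Invertible (2 : R)] {ι : Type*} [Fintype ι] [DecidableEq ι]
  [TopologicalSpace R] [IsTopologicalAddGroup R] {ψ : AddChar R Circle} (hl : IsLocallyConstant (⇑ψ : R → Circle))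
  (J : Matrix ι ι R)
  (hb : ∀ y : ι → R, Continuous fun u : ι → R => Matrix.toLinearMap₂' R J u y)
  (hb' : ∀ y : ι → R, Continuous fun u : ι → R => Matrix.toLinearMap₂' R (-J) u y)

/-- the operator of `conjPair p` is `conj ∘ op p ∘ conj`. [cite: MoeglinVignerasWaldspurger1987, Chap. 2 II.1 (A)] -/
theorem MpPsi.toOp_conjPair (p : MpPsi (schrodingerSB (Matrix.toLinearMap₂' R J) ψ hl hb)) :
    MpPsi.toOp _ (MpPsi.conjPair hl J hb hb' p) = conjOp (MpPsi.toOp _ p) :=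
  rfl

end Conj

section Diagonal

variable {K : Type*} [Field K] [ValuativeRel K] [TopologicalSpace K] [IsNonarchimedeanLocalField K]
  [Invertible (2 : K)] {κ ι : Type*} [Fintype κ] [Fintype ι] [DecidableEq κ] [DecidableEq ι]
  (e : κ ⊕ κ ≃ ι) (T₁ : Matrix κ κ K) {T : Matrix ι ι K}
  (hT : T = Matrix.reindex e e (Matrix.fromBlocks T₁ 0 0 (-T₁)))
  {ψ : AddChar K Circle} (hl : IsLocallyConstant (⇑ψ : K → Circle))
  (hb₁ : ∀ y : κ → K, Continuous fun u : κ → K => Matrix.toLinearMap₂' K T₁ u y)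
  (hb₂ : ∀ y : κ → K, Continuous fun u : κ → K => Matrix.toLinearMap₂' K (-T₁) u y)
  (hb : ∀ y : ι → K, Continuous fun u : ι → K => Matrix.toLinearMap₂' K T u y)

/-- **The operator of the diagonal doubling `j̃(p₁, conj p₂)` on `𝒮(K^{κ ⊕ κ})` is `op p₁ ⊠ (conj ∘ op p₂ ∘ conj) =
sumEndSB K e (op p₁) (conjOp (op p₂))`** — the operator under which the doubled functional `Λ = ∫_Δ ∘ (T ⊠ 1)` of a pair of
oscillator actions is quasi-invariant. [cite: MoeglinVignerasWaldspurger1987, Chap. 2 II.1 Rem. (6)] [cite: Kudla1996, Chap. I §1] -/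
theorem MpPsi.coe_toOp_boxPair_conjPair_eq_sumEndSB
    (p₁ p₂ : MpPsi (schrodingerSB (Matrix.toLinearMap₂' K T₁) ψ hl hb₁)) :
    ((MpPsi.toOp _ (MpPsi.boxPair e T₁ (-T₁) hT hl hb₁ hb₂ hb p₁ (MpPsi.conjPair hl T₁ hb₁ hb₂ p₂)) :
        SchwartzBruhat (ι → K) ≃ₗ[ℂ] SchwartzBruhat (ι → K)) : SchwartzBruhat (ι → K) →ₗ[ℂ] SchwartzBruhat (ι → K)) =
      sumEndSB K e ((MpPsi.toOp _ p₁ : SchwartzBruhat (κ → K) ≃ₗ[ℂ] _) : SchwartzBruhat (κ → K) →ₗ[ℂ] _)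
        ((conjOp (MpPsi.toOp _ p₂) : SchwartzBruhat (κ → K) ≃ₗ[ℂ] _) : SchwartzBruhat (κ → K) →ₗ[ℂ] _) := by
  rw [MpPsi.coe_toOp_boxPair_eq_sumEndSB, MpPsi.toOp_conjPair]

/-- **`ω_⊕(j̃(p₁, conj p₂)) = ω(p₁) ⊠ conjOp (op p₂)` as linear maps** — literally the operator
`sumEndSB K e (ω g) (conjOp (op (s₂ g))).toLinearMap` of the doubled quasi-invariant functional
(`MoeglinVignerasWaldspurger1987.exists_doubledFunctional_of_areIsomorphicRep`) when `p₁ = s₁ g`, `p₂ = s₂ g`.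
[cite: MoeglinVignerasWaldspurger1987, Chap. 2 II.1 Rem. (6)] [cite: Kudla1996, Chap. I §1] -/
theorem MpPsi.toRep_boxPair_conjPair_eq_sumEndSB
    (p₁ p₂ : MpPsi (schrodingerSB (Matrix.toLinearMap₂' K T₁) ψ hl hb₁)) :
    MpPsi.toRep (schrodingerSB (Matrix.toLinearMap₂' K T) ψ hl hb)
        (MpPsi.boxPair e T₁ (-T₁) hT hl hb₁ hb₂ hb p₁ (MpPsi.conjPair hl T₁ hb₁ hb₂ p₂)) =
      sumEndSB K e (MpPsi.toRep (schrodingerSB (Matrix.toLinearMap₂' K T₁) ψ hl hb₁) p₁)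
        ((conjOp (MpPsi.toOp _ p₂) : SchwartzBruhat (κ → K) ≃ₗ[ℂ] _) : SchwartzBruhat (κ → K) →ₗ[ℂ] _) :=
  MpPsi.coe_toOp_boxPair_conjPair_eq_sumEndSB e T₁ hT hl hb₁ hb₂ hb p₁ p₂

end Diagonal

end Literature.RepresentationTheory.HeisenbergGroup

end
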